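import Summits.Ventures.YMGap.RobustBall.WilsonStringTension
import HarnessLib

/-!
# Venture YMGap, track ROBUST-BALL — Wilson's joint formula: `σ = -lim_{R,T→∞} log W(R,T)/(RT)`

HONEST FRAMING. WHAT THIS IS: a venture file (cell `pub-ymgap`, track Y2, seat rb-p2 g3): a LATTICE
statement about the infinite-volume limit states of Wilson's `SU(N)` lattice gauge theory (subsequential
limits of the torus Wilson states; tree coupling `β`), valid at EVERY `β > 0`. WHAT IT IS NOT: nothing
about non-Wilson members of the robust ball, the continuum limit, a spectral gap, or a Clay-sense gap.

RESULT (`hasStringTension'`): for `G ≅ SU(N)`, `N ≥ 2`, `d ≥ 2`, every `β > 0` and every infinite-volume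
limit point `μ`, the JOINT limit `-log W_μ(R,T)/(RT) → σ(μ)` as `(R,T) → ∞` in `ℕ × ℕ` exists and equals
the iterated string tension `σ(μ) = stringTension μ χ_N` (`HasStringTension'`, the secondary form of
`Literature/…/WilsonLoops.lean`, recorded there «for comparison only» because the existence of the joint
limit «is not a theorem in print in this generality»). PROOF: all loops are positive
(`WilsonStringTension.rectExpectation_pos`); by the two reflection-positivity log-convexities
(`rectExpectation_nonneg_and_logConvex`, `…_snd`) with `W(0,T) = W(R,0) = 1`, the function
`f(R,T) = -log W(R,T)/(RT)` is non-increasing in each variable on `R, T ≥ 1`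
(`neg_log_div_antitone` — a convex sequence vanishing at `0` has non-decreasing slopes `c(n)/n`); hence
`σ ≤ V(R)/R ≤ f(R,T)` (limits of non-increasing sequences are infima) and `f(R₀,T₀) < σ + ε` for
suitable `R₀, T₀`, so `|f - σ| < ε` beyond `(R₀,T₀)`.

References: K. Wilson, Phys. Rev. D 10 (1974) 2445 (the formula); E. Seiler, LNP 159 (1982) §2
(iterated form); C. Bachas, Phys. Rev. D 33 (1986) 2723 (convexity). Everything here is proved;
no definition, no named fact. [folklore]
-/

noncomputable section

open MeasureTheory Filter Topology Finset
open Literature.Probability.LatticeModels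
open Literature.MathematicalPhysics.QuantumLattice Literature.MathematicalPhysics.QuantumFieldTheory

namespace Summit.Ventures.YMGap.RobustBall

namespace WilsonStringTensionJoint

/-! ### A convex sequence vanishing at `0` has non-decreasing slopes -/

/-- If `c 0 = 0` and `c` is convex (`2 c(n+1) ≤ c n + c(n+2)`), then `(n+1) c n ≤ n c (n+1)` for all
`n ≥ 1`, i.e. the slopes `c n / n` do not decrease. [folklore] -/
theorem succ_mul_le_mul_succ_of_convex {c : ℕ → ℝ} (h0 : c 0 = 0)
    (hc : ∀ n, 2 * c (n + 1) ≤ c n + c (n + 2)) :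
    ∀ n : ℕ, 1 ≤ n → ((n : ℝ) + 1) * c n ≤ (n : ℝ) * c (n + 1) := by
  intro n hn
  induction n with
  | zero => omega
  | succ k ih =>
    rcases Nat.eq_zero_or_pos k with rfl | hk
    · have := hc 0
      rw [h0] at this
      norm_num at this ⊢
      linarith
    · have ihk := ih hk
      have hck := hc k
      have hck1 := hc (k + 1)
      push_cast at ihk hck hck1 ⊢
      nlinarith

/-- Slopes of a convex sequence vanishing at `0`: `c m / m ≤ c n / n` for `1 ≤ m ≤ n`. [folklore] -/
theorem div_le_div_of_convex {c : ℕ → ℝ} (h0 : c 0 = 0)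
    (hc : ∀ n, 2 * c (n + 1) ≤ c n + c (n + 2)) {m n : ℕ} (hm : 1 ≤ m) (hmn : m ≤ n) :
    c m / m ≤ c n / n := by
  induction n, hmn using Nat.le_induction with
  | base => exact le_rfl
  | succ k hmk ih =>
    refine ih.trans ?_
    have hk : 1 ≤ k := hm.trans hmk
    have hk0 : (0 : ℝ) < k := by exact_mod_cast hk
    have h := succ_mul_le_mul_succ_of_convex h0 hc k hk
    rw [div_le_div_iff₀ hk0 (by positivity)]
    push_cast
    linarith

/-- **`-log W(n)/n` is non-increasing** for a positive log-convex sequence with `W 0 = 1`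
(`1 ≤ m ≤ n ⇒ -log W(n)/n ≤ -log W(m)/m`). [folklore] -/
theorem neg_log_div_antitone {W : ℕ → ℝ} (h0 : W 0 = 1) (hpos : ∀ n, 0 < W n)
    (hconv : ∀ n, W (n + 1) ^ 2 ≤ W n * W (n + 2)) {m n : ℕ} (hm : 1 ≤ m) (hmn : m ≤ n) :
    -Real.log (W n) / n ≤ -Real.log (W m) / m := by
  have hc : ∀ k, 2 * Real.log (W (k + 1)) ≤ Real.log (W k) + Real.log (W (k + 2)) := fun k => by
    have h := Real.log_le_log (pow_pos (hpos (k + 1)) 2) (hconv k)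
    rw [Real.log_pow, Real.log_mul (hpos k).ne' (hpos (k + 2)).ne'] at h
    simpa using h
  have h := div_le_div_of_convex (c := fun k => Real.log (W k)) (by simp [h0]) hc hm hmn
  rw [neg_div, neg_div]
  exact neg_le_neg h

/-! ### The joint limit -/

section Joint

variable {d N : ℕ} [NeZero d] {G : Type*} [Group G] [TopologicalSpace G] [IsTopologicalGroup G]
  [CompactSpace G] [MeasurableSpace G] [BorelSpace G] [SecondCountableTopology G] [T2Space G]
  (ρ : G →* Matrix (Fin N) (Fin N) ℂ)

/-- **WILSON'S JOINT FORMULA FOR THE STRING TENSION.** For `G ≅ SU(N)`, `N ≥ 2`, `d ≥ 2`, every `β > 0`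
and every infinite-volume limit point `μ` of the torus Wilson states, the loops are eventually (indeed
always) non-zero and `-log |W_μ(R,T)| / (RT) → stringTension μ χ_N` as `(R,T) → ∞` jointly in
`ℕ × ℕ` (`HasStringTension'`); in particular the joint and the iterated string tensions coincide.
[folklore] -/
theorem hasStringTension' (hρ : IsSpecialUnitaryModel ρ) (hN : 2 ≤ N) (hd : 2 ≤ d) {β : ℝ}
    (hβ : 0 < β) {μ : Measure (LGConfig d G)} (hμ : μ ∈ infiniteVolumeLimitPoints ρ β) :
    HasStringTension' μ (fun g => normalisedCharacter N (ρ g))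
      (stringTension μ (fun g => normalisedCharacter N (ρ g))) := by
  set χ : G → ℝ := fun g => normalisedCharacter N (ρ g) with hχ
  have hpos := WilsonStringTension.rectExpectation_pos ρ hρ hN hd hβ hμ
  have hW := WilsonStringTension.rectExpectation_ne_zero ρ hρ hN hd hβ hμ
  have hN0 : N ≠ 0 := by omega
  set σ : ℝ := stringTension μ χ with hσdef
  set V : ℕ → ℝ := fun R => staticPotential μ χ R with hVdef
  -- the iterated limits (lit-1's concavity file, hypothesis-free by `hW`)
  have hV : ∀ R : ℕ, Tendsto (fun T : ℕ => -Real.log (rectExpectation μ χ 0 1 R T) / T) atTop (𝓝 (V R)) :=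
    fun R => StaticPotential.tendsto_neg_log_div_staticPotential ρ hd hρ.1 hβ.le hμ hW R
  have hσ : Tendsto (fun R : ℕ => V R / R) atTop (𝓝 σ) := by
    obtain ⟨-, V', hV', hlim⟩ := StaticPotential.stringTension_nonneg_and_hasStringTension ρ hd hρ.1 hβ.le hμ hW
    refine hlim.congr' ?_
    filter_upwards [eventually_ge_atTop 1] with R hR
    rw [hVdef]
    simp only
    rw [(hV' R hR).staticPotential_eq]
  obtain ⟨φ, hφ, hlim⟩ := id hμ
  haveI : IsProbabilityMeasure μ := hlim.1
  -- degenerate rectangles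
  have hχinv : ∀ g, χ g⁻¹ = χ g := fun g => by
    simp only [hχ, normalisedCharacter,
      Literature.RepresentationTheory.CompactGroups.CompactGroup.re_trace_map_inv ρ hρ.1]
  have hR0 : ∀ T : ℕ, rectExpectation μ χ 0 1 0 T = 1 := fun T => rectExpectation_zero_eq_one ρ hN0 μ 0 1 T
  have hT0 : ∀ R : ℕ, rectExpectation μ χ 0 1 R 0 = 1 := fun R => by
    haveI : IsProbabilityMeasure (μ.map (configPermZd (G := G) (Equiv.swap (0 : Fin d) 1))) :=
      Measure.isProbabilityMeasure_map (configPermZd _).measurable.aemeasurable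
    rw [rectExpectation_eq_swap μ χ hχinv R 0]
    exact rectExpectation_zero_eq_one ρ hN0 _ 0 1 R
  -- monotonicity in each variable (`R, T ≥ 1`)
  have hantiT : ∀ R : ℕ, ∀ {m n : ℕ}, 1 ≤ m → m ≤ n →
      -Real.log (rectExpectation μ χ 0 1 R n) / n ≤ -Real.log (rectExpectation μ χ 0 1 R m) / m :=
    fun R m n hm hmn => neg_log_div_antitone (W := fun T => rectExpectation μ χ 0 1 R T) (hT0 R)
      (fun T => hpos R T)
      (fun T => (StaticPotential.rectExpectation_nonneg_and_logConvex_snd ρ hd hρ.1 hβ.le hφ hlim R T).2) hm hmn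
  have hantiR : ∀ T : ℕ, ∀ {m n : ℕ}, 1 ≤ m → m ≤ n →
      -Real.log (rectExpectation μ χ 0 1 n T) / n ≤ -Real.log (rectExpectation μ χ 0 1 m T) / m :=
    fun T m n hm hmn => neg_log_div_antitone (W := fun R => rectExpectation μ χ 0 1 R T) (hR0 T)
      (fun R => hpos R T)
      (fun R => (rectExpectation_nonneg_and_logConvex ρ hd hρ.1 hβ.le hφ hlim T R).2) hm hmn
  -- `V R ≤ -log W(R,T)/T` for `T ≥ 1` and `σ ≤ V R / R` for `R ≥ 1` (limits of non-increasing sequences)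
  have hVle : ∀ R T : ℕ, 1 ≤ T → V R ≤ -Real.log (rectExpectation μ χ 0 1 R T) / T := by
    intro R T hT
    have hanti : Antitone fun k : ℕ => -Real.log (rectExpectation μ χ 0 1 R (k + 1)) / ((k + 1 : ℕ) : ℝ) :=
      antitone_nat_of_succ_le fun k => hantiT R (by omega) (by omega)
    have hlimk : Tendsto (fun k : ℕ => -Real.log (rectExpectation μ χ 0 1 R (k + 1)) / ((k + 1 : ℕ) : ℝ))
        atTop (𝓝 (V R)) := (hV R).comp (tendsto_add_atTop_nat 1)
    have h := hanti.le_of_tendsto hlimk (T - 1)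
    have hT' : T - 1 + 1 = T := by omega
    simpa [hT'] using h
  have hσle : ∀ R : ℕ, 1 ≤ R → σ ≤ V R / R := by
    intro R hR
    have hanti : Antitone fun k : ℕ => V (k + 1) / ((k + 1 : ℕ) : ℝ) :=
      antitone_nat_of_succ_le fun k =>
        StaticPotential.staticPotential_div_le_div ρ hd hρ.1 hβ.le hμ hW (m := k + 1) (n := k + 1 + 1)
          (by omega) (by omega)
    have hlimk : Tendsto (fun k : ℕ => V (k + 1) / ((k + 1 : ℕ) : ℝ)) atTop (𝓝 σ) :=
      hσ.comp (tendsto_add_atTop_nat 1)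
    have h := hanti.le_of_tendsto hlimk (R - 1)
    have hR' : R - 1 + 1 = R := by omega
    simpa [hR'] using h
  -- lower bound `σ ≤ f(R,T)`
  have hlow : ∀ R T : ℕ, 1 ≤ R → 1 ≤ T →
      σ ≤ -Real.log (rectExpectation μ χ 0 1 R T) / ((R : ℝ) * T) := by
    intro R T hR hT
    have hRpos : (0 : ℝ) < R := by exact_mod_cast hR
    calc σ ≤ V R / R := hσle R hR
      _ ≤ (-Real.log (rectExpectation μ χ 0 1 R T) / T) / R :=
          div_le_div_of_nonneg_right (hVle R T hT) hRpos.le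
      _ = -Real.log (rectExpectation μ χ 0 1 R T) / ((R : ℝ) * T) := by
          rw [div_div, mul_comm]
  refine ⟨Eventually.of_forall fun p => (hpos p.1 p.2).ne', ?_⟩
  have habs : ∀ R T : ℕ, |rectExpectation μ χ 0 1 R T| = rectExpectation μ χ 0 1 R T :=
    fun R T => abs_of_pos (hpos R T)
  simp_rw [habs]
  rw [Metric.tendsto_atTop]
  intro ε hε
  -- choose `R₀` with `V R₀ / R₀ < σ + ε/2`, then `T₀` with `-log W(R₀,T₀)/T₀ < V R₀ + R₀ ε/2`
  obtain ⟨R₀, hR₀⟩ := ((hσ.eventually (gt_mem_nhds (show σ < σ + ε / 2 by linarith))).and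
    (eventually_ge_atTop 1)).exists
  obtain ⟨hR₀lt, hR₀1⟩ := hR₀
  have hR₀pos : (0 : ℝ) < R₀ := by exact_mod_cast hR₀1
  obtain ⟨T₀, hT₀⟩ := (((hV R₀).eventually (gt_mem_nhds (show V R₀ < V R₀ + R₀ * (ε / 2) by
    nlinarith))).and (eventually_ge_atTop 1)).exists
  obtain ⟨hT₀lt, hT₀1⟩ := hT₀
  refine ⟨(R₀, T₀), fun p hp => ?_⟩
  obtain ⟨hp1, hp2⟩ := Prod.le_def.1 hp
  have hp1' : 1 ≤ p.1 := hR₀1.trans hp1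
  have hp2' : 1 ≤ p.2 := hT₀1.trans hp2
  have hRpos : (0 : ℝ) < p.1 := by exact_mod_cast hp1'
  -- upper bound by monotonicity: `f p ≤ f (R₀, p.2) ≤ f (R₀, T₀) < σ + ε`
  have hup : -Real.log (rectExpectation μ χ 0 1 p.1 p.2) / ((p.1 : ℝ) * p.2) < σ + ε := by
    have h1 : -Real.log (rectExpectation μ χ 0 1 p.1 p.2) / ((p.1 : ℝ) * p.2) ≤
        -Real.log (rectExpectation μ χ 0 1 R₀ p.2) / ((R₀ : ℝ) * p.2) := by
      have hT : (0 : ℝ) < p.2 := by exact_mod_cast hp2'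
      have h := hantiR p.2 hR₀1 hp1
      rw [← div_div, ← div_div]
      exact div_le_div_of_nonneg_right h hT.le
    have h2 : -Real.log (rectExpectation μ χ 0 1 R₀ p.2) / ((R₀ : ℝ) * p.2) ≤
        -Real.log (rectExpectation μ χ 0 1 R₀ T₀) / ((R₀ : ℝ) * T₀) := by
      have h := hantiT R₀ hT₀1 hp2
      rw [← div_div, ← div_div, div_right_comm, div_right_comm (-Real.log (rectExpectation μ χ 0 1 R₀ T₀))]
      exact div_le_div_of_nonneg_right h hR₀pos.le
    have h3 : -Real.log (rectExpectation μ χ 0 1 R₀ T₀) / ((R₀ : ℝ) * T₀) < σ + ε := by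
      have hT₀pos : (0 : ℝ) < T₀ := by exact_mod_cast hT₀1
      have : -Real.log (rectExpectation μ χ 0 1 R₀ T₀) / ((R₀ : ℝ) * T₀) =
          (-Real.log (rectExpectation μ χ 0 1 R₀ T₀) / T₀) / R₀ := by
        rw [div_div, mul_comm]
      rw [this, div_lt_iff₀ hR₀pos]
      have hq : V R₀ / R₀ < σ + ε / 2 := hR₀lt
      rw [div_lt_iff₀ hR₀pos] at hq
      nlinarith
    linarith
  have hlo := hlow p.1 p.2 hp1' hp2'
  rw [Real.dist_eq, abs_lt]
  constructor <;> linarith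

end Joint

end WilsonStringTensionJoint

end Summit.Ventures.YMGap.RobustBall
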